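import Summits.ResolutionOfSingularities.ResolutionOfSingularities.Theorems.FrobeniusLadderFRationalResolutionIsolatedGlue
import Summits.ResolutionOfSingularities.ResolutionOfSingularities.Theorems.FrobeniusLadderFRationalResolutionConeModels
import Summits.ResolutionOfSingularities.ResolutionOfSingularities.Theorems.FrobeniusLadderFRationalResolutionRegularLocusOpenImmersion
import Literature.AlgebraicGeometry.Resolution.ResolutionGlue
import HarnessLib

/-!
# Crux `FrobeniusLadder.FRationalResolution` (stmt-ResolutionOfSingularities-15317), line `redirect`,
# stub `stub_diagonalizableQuotientResolution` — **the induction step of the point-blow-up recursion at the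
# level of models: a point blow-up whose singular points carry local resolutions is a local-resolution datum**
# (brick P7-d of memo MEMO-15317-leafhand2-g8; generalises `…ConeModels.affineBlowup_model_datum` from
# "`Bl_I(Spec R)` regular" to "`Bl_I(Spec R)` has finitely many singular points, each with `hloc`")

Generic (no log geometry). DATA: `R` a domain of finite type over a field `k`, `I ⊆ R` finitely generated and
non-zero with `Reg (Spec R) = Spec R ∖ V(I)`; the affine blow-up `Y = Bl_I(Spec R)` (`affineBlowup I`) has
finitely many singular points and each carries the local resolution datum `hloc` of `…IsolatedGlue` (an open
`V ∋ y` with no other singular point and a proper `Y' → V`, `Y'` regular, an isomorphism over `V ∩ Reg Y` with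
dense preimage). RESULT **`model_datum_of_local_resolutions`**: there is a proper `ρ : Z → Spec R` with `Z`
regular which is an isomorphism over `⨆_{a ∈ I} D(a)` with dense preimage — the `hres` input of
`…LocalModelTransfer.hloc_of_stalk_iso_model` / `…ConeModels.hloc_of_cone_model`'s pattern. Proof: glue the
local resolutions on `Y` by `stub_hasResolution_of_local_resolutions` and compose with `Bl_I(Spec R) → Spec R`,
an isomorphism over `⨆ D(a)` (`affineBlowup.isIso_morphismRestrict_iSup`), whose preimage is regular
(`preimage_regularLocus_of_isOpenImmersion`) and dense (`affineBlowup.dense_preimage_basicOpen_of_mem_nonZeroDivisors`).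

Honest label: scheme plumbing toward ONE leaf stub (no stub, crux or summit closed). No definitions, no named
facts, no sorry. [cite: Kollar2007, §2.2] [cite: GortzWedhorn2020, Prop. 13.91] [cite: StacksProject, Tag 02OS]
-/

noncomputable section

-- single-problem summit: the doubled namespace component is forced
set_option linter.dupNamespace false

open CategoryTheory AlgebraicGeometry TopologicalSpace
open Literature.AlgebraicGeometry.Resolution

namespace Summit.ResolutionOfSingularities.ResolutionOfSingularities.Theorems.FRationalResolution.TwoStepModel

/-- **A point blow-up whose singular points carry local resolutions is a local-resolution datum.** See the
module docstring. [cite: Kollar2007, §2.2] [cite: StacksProject, Tag 02OS] -/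
theorem model_datum_of_local_resolutions (k : Type) [Field k] {R : Type} [CommRing R] [IsDomain R]
    [Algebra k R] [Algebra.FiniteType k R] (I : Ideal R) (hfg : I.FG) (hI : I ≠ ⊥)
    (hRegI : ∀ P : Spec (.of R), P ∈ Scheme.regularLocus (Spec (.of R)) ↔ ¬ I ≤ P.asIdeal)
    (hopen : IsOpen (Scheme.regularLocus (affineBlowup I)))
    (hfin : (Scheme.regularLocus (affineBlowup I))ᶜ.Finite)
    (hloc : ∀ y : affineBlowup I, y ∉ Scheme.regularLocus (affineBlowup I) →
      ∃ (V : (affineBlowup I).Opens), y ∈ V ∧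
        (∀ t : affineBlowup I, t ∉ Scheme.regularLocus (affineBlowup I) → t ∈ V → t = y) ∧
        ∃ (Y' : Scheme.{0}) (ρ : Y' ⟶ V), IsProper ρ ∧ Scheme.IsRegular Y' ∧
          IsIso (ρ ∣_ (V.ι ⁻¹ᵁ ⟨Scheme.regularLocus (affineBlowup I), hopen⟩)) ∧
          Dense ((ρ ⁻¹ᵁ (V.ι ⁻¹ᵁ ⟨Scheme.regularLocus (affineBlowup I), hopen⟩) : Y'.Opens) : Set Y')) :
    ∃ (Z : Scheme.{0}) (ρ : Z ⟶ Spec (.of R)), IsProper ρ ∧ Scheme.IsRegular Z ∧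
      IsIso (ρ ∣_ ⨆ a : I, (PrimeSpectrum.basicOpen (a : R) : (Spec (.of R)).Opens)) ∧
      Dense ((ρ ⁻¹ᵁ ⨆ a : I, (PrimeSpectrum.basicOpen (a : R) : (Spec (.of R)).Opens) : Z.Opens) :
        Set Z) := by
  classical
  set π := affineBlowup.π I with hπdef
  set W : (Spec (.of R)).Opens := ⨆ a : I, (PrimeSpectrum.basicOpen (a : R) : (Spec (.of R)).Opens)
    with hWdef
  set U : (affineBlowup I).Opens := ⟨Scheme.regularLocus (affineBlowup I), hopen⟩ with hU
  have hmemU : ∀ y : affineBlowup I, y ∈ U ↔ IsRegularLocalRing ((affineBlowup I).presheaf.stalk y) :=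
    fun y => Iff.rfl
  have hUreg : Scheme.IsRegular (U : Scheme.{0}) :=
    isRegular_opens_of_stalk U fun y hy => (hmemU y).mp hy
  -- glue the local resolutions on `Y`
  set S : Finset (affineBlowup I) := hfin.toFinset with hS
  have hmemS : ∀ y : affineBlowup I, y ∈ S ↔ y ∉ Scheme.regularLocus (affineBlowup I) := fun y => by
    rw [hS, Set.Finite.mem_toFinset]; rfl
  have hcov : ∀ y : affineBlowup I, y ∈ U ∨ y ∈ S := fun y => by
    by_cases hy : y ∈ Scheme.regularLocus (affineBlowup I)
    · exact Or.inl hy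
    · exact Or.inr ((hmemS y).mpr hy)
  have hloc' : ∀ s ∈ S, ∃ (V : (affineBlowup I).Opens), s ∈ V ∧ (∀ t ∈ S, t ∈ V → t = s) ∧
      ∃ (Y' : Scheme.{0}) (ρ : Y' ⟶ V), IsProper ρ ∧ Scheme.IsRegular Y' ∧
        IsIso (ρ ∣_ (V.ι ⁻¹ᵁ U)) ∧ Dense ((ρ ⁻¹ᵁ (V.ι ⁻¹ᵁ U) : Y'.Opens) : Set Y') := by
    intro s hs
    obtain ⟨V, hsV, hVS, Y', ρ, hρ, hY', hiso, hd⟩ := hloc s ((hmemS s).mp hs)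
    exact ⟨V, hsV, fun t ht htV => hVS t ((hmemS t).mp ht) htV, Y', ρ, hρ, hY', hiso, hd⟩
  obtain ⟨Z, π', hπ', hZreg, hiso, hd⟩ := stub_hasResolution_of_local_resolutions (affineBlowup I) U hUreg S hcov hloc'
  haveI := hπ'
  haveI : IsProper π := affineBlowup.isProper_of_fg I hfg
  -- the points of `Y` over `W` are regular: `π ⁻¹ W ≤ U`
  haveI : LocallyOfFiniteType (Spec.map (CommRingCat.ofHom (algebraMap k R))) := by
    rw [HasRingHomProperty.Spec_iff (P := @LocallyOfFiniteType), CommRingCat.hom_ofHom]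
    exact RingHom.finiteType_algebraMap.mpr inferInstance
  have hRegR : IsOpen (Scheme.regularLocus (Spec (.of R))) :=
    isOpen_regularLocus_of_locallyOfFiniteType_field (Spec.map (CommRingCat.ofHom (algebraMap k R)))
  have hle : π ⁻¹ᵁ W ≤ U := by
    intro y hy
    -- the open immersion `π ⁻¹ W ↪ Spec R`
    let j : ((π ⁻¹ᵁ W : (affineBlowup I).Opens) : Scheme.{0}) ⟶ Spec (.of R) := (π ⁻¹ᵁ W).ι ≫ π
    have hj : j = (π ∣_ W) ≫ W.ι := (morphismRestrict_ι π W).symm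
    haveI : IsIso (π ∣_ W) := affineBlowup.isIso_morphismRestrict_iSup (I := I)
    haveI : IsOpenImmersion j := by rw [hj]; infer_instance
    have hpre := preimage_regularLocus_of_isOpenImmersion (π ⁻¹ᵁ W) j hopen hRegR
    have hyW : π y ∈ W := hy
    have hreg : π y ∈ Scheme.regularLocus (Spec (.of R)) := by
      rw [hRegI]
      obtain ⟨⟨a, haI⟩, ha⟩ := Opens.mem_iSup.mp hyW
      exact SetLike.not_le_iff_exists.mpr ⟨a, haI, (PrimeSpectrum.mem_basicOpen _ _).mp ha⟩
    have h1 : (⟨y, hy⟩ : (π ⁻¹ᵁ W : (affineBlowup I).Opens)) ∈ j ⁻¹ᵁ ⟨Scheme.regularLocus (Spec (.of R)), hRegR⟩ := by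
      show j.base ⟨y, hy⟩ ∈ Scheme.regularLocus (Spec (.of R))
      have : j.base ⟨y, hy⟩ = π y := by
        show (π.base) ((π ⁻¹ᵁ W).ι.base ⟨y, hy⟩) = π y
        rw [Scheme.Opens.ι_apply]
      rw [this]; exact hreg
    rw [hpre] at h1
    exact h1
  -- the composite
  refine ⟨Z, π' ≫ π, inferInstance, hZreg, ?_, ?_⟩
  · rw [morphismRestrict_comp]
    have i1 : IsIso (π' ∣_ (π ⁻¹ᵁ W)) := isIso_morphismRestrict_of_le π' hiso hle
    have i2 : IsIso (π ∣_ W) := affineBlowup.isIso_morphismRestrict_iSup (I := I)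
    exact @IsIso.comp_isIso _ _ _ _ _ _ _ i1 i2
  · -- density: `π ⁻¹ W` is dense in `Y`, and `π'` is an isomorphism over `U ⊇ π ⁻¹ W` with dense preimage
    obtain ⟨a, haI, ha0⟩ := Submodule.exists_mem_ne_zero_of_ne_bot hI
    have ha : a ∈ nonZeroDivisors R := mem_nonZeroDivisors_of_ne_zero ha0
    have hWle : (PrimeSpectrum.basicOpen a : (Spec (.of R)).Opens) ≤ W :=
      le_iSup (fun b : I => (PrimeSpectrum.basicOpen (b : R) : (Spec (.of R)).Opens)) ⟨a, haI⟩
    have hdW : Dense ((π ⁻¹ᵁ W : (affineBlowup I).Opens) : Set (affineBlowup I)) :=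
      (affineBlowup.dense_preimage_basicOpen_of_mem_nonZeroDivisors (I := I) ha).mono fun y hy => hWle hy
    have h1 := dense_preimage_inter_of_isIso_morphismRestrict π' hiso hd hdW
    have h2 : ((U : Set (affineBlowup I)) ∩ (π ⁻¹ᵁ W : (affineBlowup I).Opens)) =
        ((π ⁻¹ᵁ W : (affineBlowup I).Opens) : Set (affineBlowup I)) :=
      Set.inter_eq_right.mpr fun y hy => hle hy
    rw [h2] at h1
    exact h1

end Summit.ResolutionOfSingularities.ResolutionOfSingularities.Theorems.FRationalResolution.TwoStepModel

end
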